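/-
Lead `ym-line-sgb-p2` (gen 1, seat prover-ym-line-sgb-p2-g1-0), route `SteinGapBootstrap`, crux item
stmt-QuantumFields-23800 `UProbeCovFromPairLaw` ≡ stmt-QuantumFields-23640 `ProbeCovFromPairLawG`.
SKELETON (line `direct`): stubs `stub_gaussTest`, `stub_axisProbe`, `stub_gaussSide`, `stub_assembly`;
`ProbeCovFromPairLawG_of` / `UProbeCovFromPairLaw_of` conclude the crux decls BY NAME modulo the stubs.
-/
import Summits.QuantumFields.YangMills.Theses.SteinGapBootstrap
import Summits.QuantumFields.YangMills.Theorems.EquipartitionCriticalityEquipartitionPinsProbeTangentDefs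
import Literature.MathematicalPhysics.QuantumFieldTheory.LatticeMaxwellBlockOU
import Literature.MathematicalPhysics.QuantumFieldTheory.CurvatureGaussianField
import HarnessLib

/-!
# Route `SteinGapBootstrap`: `ProbeCovFromPairLawG` (stmt-QuantumFields-23640) ≡ `UProbeCovFromPairLaw`
# (stmt-QuantumFields-23800) — skeleton of line `direct`

NOT THE CLAY GAP: the route bears on the RECORD-label rung leaf R2ξ′ `WeakCouplingRates.XiPow` (an upper bound on the
lattice mass gap of torus-limit states); nothing here proves a summit statement.

The crux: smooth-metric closeness `η` of the pair law of the rescaled comb-gauge plaquette field `(Y_{p₀}, Y_{p_n})`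
(`plaqField r β`, `p₀ = plaquette₁₂(0)`, `p_n = plaquette₁₂(n e₀)`) to the lattice-Maxwell block law `γ_B`, plus
equipartition `E_μ(N − Re tr r(U_p)) ≤ C₀/β`, give `|Cov_μ(P, P∘τ_n) − g_D(n)| ≤ Cη + Cβ^{-δ}` for the probe
`P = exp(−2(β(N − Re tr r(U_{p₀})))₊)`.

Line `direct` (three lemmas + bookkeeping):
* `stub_axisProbe` — LATTICE SIDE, pointwise: at every `(1,2)`-plaquette based on the `e₀` axis the comb gauge puts the
  holonomy on ONE non-comb link, so `Y_p = √β · lieCoord(ρ(Ũ_p) − 1)` exactly and the tangent defect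
  (`stub_tangentDefect`: `0 ≤ 2E − Σ c² ≤ K E²`) gives `|exp(−2(βE_p)₊) − exp(−|Y_p|²)| ≤ min(1, K β E_p²) ≤ √K √β E_p`;
* `stub_gaussTest` — the Gaussian test functions `z ↦ e^{−|z_p|²}`, `z ↦ e^{−|z_p|²} e^{−|z_q|²}` on the block space are
  smooth with first and second derivatives bounded by a constant depending only on `D`;
* `stub_gaussSide` — under `γ_B` the covariance of `e^{−|z_p|²}`, `e^{−|z_q|²}` is `2^{−D}((1 − c²)^{−D/2} − 1)`,
  `c = curvatureTwoPoint p q` (tree `GaussianProfile.covariance_formula` transported by `integral_latticeMaxwellBlockLaw`);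
* `stub_assembly` — bookkeeping: `δ = 1/2`, `C = 3L + 4√K C₀ + 1`, `β₀ = 1`.

References: E. Meckes, IMS Collections 5 (2009) 153–178, Lemma 1–2 [Meckes2009]; S. Chatterjee, arXiv:1602.01222 §§9–11
[arXiv160201222].
-/

set_option autoImplicit false

noncomputable section

namespace Summit.QuantumFields.YangMills.Theorems.SteinGapBootstrap

open MeasureTheory
open Literature.MathematicalPhysics.QuantumLattice Literature.MathematicalPhysics.QuantumFieldTheory
open Summit.QuantumFields.YangMills.Theorems.EquipartitionPinsProbe
open Summit.QuantumFields.YangMills.Theses.SteinGapBootstrap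

namespace ProbeCovDirect

/-- STUB `stub_axisProbe` — **lattice side, pointwise** (comb gauge on the `e₀` axis + tangent defect): for a lattice
representation `r` of a compact group there is `K ≥ 0` such that for every `β > 0`, every site `x` with `x₂ = x₃ = 0`
and every configuration `U`, with `E = N − Re tr ρ(U_{(x;1,2)})`,
`|exp(−2(βE)₊) − exp(−Σ_a (Y^β_{(x;1,2)})_a²)| ≤ K √β E`. -/
theorem stub_axisProbe :
    ∀ (G : Type) [Group G] [TopologicalSpace G] [CompactSpace G]
      (r : Literature.MathematicalPhysics.QuantumFieldTheory.LatticeRep G), ∃ K : ℝ, 0 ≤ K ∧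
      ∀ (β : ℝ), 0 < β → ∀ (x : Literature.Probability.LatticeModels.Site 4), (∀ j : Fin 4, 1 < j → x j = 0) →
        ∀ U : Literature.MathematicalPhysics.QuantumLattice.LGConfig 4 G,
          |Real.exp (-2 * max (β * ((r.N : ℝ) - Literature.MathematicalPhysics.QuantumLattice.plaquetteObs r.ρ x 1 2 U)) 0) -
              Real.exp (-(∑ a : Fin (Summit.QuantumFields.YangMills.Theorems.EquipartitionPinsProbe.lieDim r),
                (Summit.QuantumFields.YangMills.Theorems.EquipartitionPinsProbe.plaqField r β U
                  (Literature.MathematicalPhysics.QuantumFieldTheory.plaquette12 (d := 4) (by norm_num) x) a) ^ 2))| ≤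
            K * Real.sqrt β * ((r.N : ℝ) - Literature.MathematicalPhysics.QuantumLattice.plaquetteObs r.ρ x 1 2 U) := by
  sorry

/-- STUB `stub_gaussTest` — **the Gaussian test functions have bounded `C²` norms, uniformly in the block**: for every
`D` there is `L > 0` such that for every finite block `B` of plaquettes and `p, q ∈ B` the functions
`z ↦ exp(−Σ_a z_p^a²)` and `z ↦ exp(−Σ_a z_p^a²) exp(−Σ_a z_q^a²)` on `↥B → Fin D → ℝ` are smooth with
`‖∇h‖ ≤ L`, `‖∇²h‖ ≤ L` everywhere. -/
theorem stub_gaussTest :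
    ∀ (D : ℕ), ∃ L : ℝ, 0 < L ∧
      ∀ (B : Finset (Literature.MathematicalPhysics.QuantumLattice.ZdPlaquette 4)) (p q : ↥B),
        (ContDiff ℝ (⊤ : ℕ∞) (fun z : ↥B → Fin D → ℝ => Real.exp (-(∑ a : Fin D, (z p a) ^ 2))) ∧
          ∀ z : ↥B → Fin D → ℝ,
            ‖fderiv ℝ (fun z : ↥B → Fin D → ℝ => Real.exp (-(∑ a : Fin D, (z p a) ^ 2))) z‖ ≤ L ∧
            ‖iteratedFDeriv ℝ 2 (fun z : ↥B → Fin D → ℝ => Real.exp (-(∑ a : Fin D, (z p a) ^ 2))) z‖ ≤ L) ∧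
        (ContDiff ℝ (⊤ : ℕ∞) (fun z : ↥B → Fin D → ℝ =>
            Real.exp (-(∑ a : Fin D, (z p a) ^ 2)) * Real.exp (-(∑ a : Fin D, (z q a) ^ 2))) ∧
          ∀ z : ↥B → Fin D → ℝ,
            ‖fderiv ℝ (fun z : ↥B → Fin D → ℝ =>
                Real.exp (-(∑ a : Fin D, (z p a) ^ 2)) * Real.exp (-(∑ a : Fin D, (z q a) ^ 2))) z‖ ≤ L ∧
            ‖iteratedFDeriv ℝ 2 (fun z : ↥B → Fin D → ℝ =>
                Real.exp (-(∑ a : Fin D, (z p a) ^ 2)) * Real.exp (-(∑ a : Fin D, (z q a) ^ 2))) z‖ ≤ L) := by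
  sorry

/-- STUB `stub_gaussSide` — **the Gaussian side**: under the block law `γ_B = latticeMaxwellBlockLaw B D` the covariance
of `e^{−|z_p|²}` and `e^{−|z_q|²}` is `2^{−D}((1 − c²)^{−D/2} − 1)` with `c = curvatureTwoPoint p q`. -/
theorem stub_gaussSide :
    ∀ (B : Finset (Literature.MathematicalPhysics.QuantumLattice.ZdPlaquette 4)) (D : ℕ) (p q : ↥B),
      (∫ z, Real.exp (-(∑ a : Fin D, (z p a) ^ 2)) * Real.exp (-(∑ a : Fin D, (z q a) ^ 2))
          ∂(Literature.MathematicalPhysics.QuantumFieldTheory.latticeMaxwellBlockLaw B D)) -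
        (∫ z, Real.exp (-(∑ a : Fin D, (z p a) ^ 2))
          ∂(Literature.MathematicalPhysics.QuantumFieldTheory.latticeMaxwellBlockLaw B D)) *
        (∫ z, Real.exp (-(∑ a : Fin D, (z q a) ^ 2))
          ∂(Literature.MathematicalPhysics.QuantumFieldTheory.latticeMaxwellBlockLaw B D)) =
      (2 : ℝ) ^ (-(D : ℝ)) *
        ((1 - (Literature.MathematicalPhysics.QuantumFieldTheory.curvatureTwoPoint (d := 4)
          (p : Literature.MathematicalPhysics.QuantumLattice.ZdPlaquette 4) q) ^ 2) ^ (-((D : ℝ) / 2)) - 1) := by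
  sorry

/-- STUB `stub_assembly` — **bookkeeping**: the three lemmas give the crux with `δ = 1/2`. -/
theorem stub_assembly
    (h₁ : ∀ (G : Type) [Group G] [TopologicalSpace G] [CompactSpace G]
      (r : Literature.MathematicalPhysics.QuantumFieldTheory.LatticeRep G), ∃ K : ℝ, 0 ≤ K ∧
      ∀ (β : ℝ), 0 < β → ∀ (x : Literature.Probability.LatticeModels.Site 4), (∀ j : Fin 4, 1 < j → x j = 0) →
        ∀ U : Literature.MathematicalPhysics.QuantumLattice.LGConfig 4 G,
          |Real.exp (-2 * max (β * ((r.N : ℝ) - Literature.MathematicalPhysics.QuantumLattice.plaquetteObs r.ρ x 1 2 U)) 0) -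
              Real.exp (-(∑ a : Fin (Summit.QuantumFields.YangMills.Theorems.EquipartitionPinsProbe.lieDim r),
                (Summit.QuantumFields.YangMills.Theorems.EquipartitionPinsProbe.plaqField r β U
                  (Literature.MathematicalPhysics.QuantumFieldTheory.plaquette12 (d := 4) (by norm_num) x) a) ^ 2))| ≤
            K * Real.sqrt β * ((r.N : ℝ) - Literature.MathematicalPhysics.QuantumLattice.plaquetteObs r.ρ x 1 2 U))
    (h₂ : ∀ (D : ℕ), ∃ L : ℝ, 0 < L ∧
      ∀ (B : Finset (Literature.MathematicalPhysics.QuantumLattice.ZdPlaquette 4)) (p q : ↥B),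
        (ContDiff ℝ (⊤ : ℕ∞) (fun z : ↥B → Fin D → ℝ => Real.exp (-(∑ a : Fin D, (z p a) ^ 2))) ∧
          ∀ z : ↥B → Fin D → ℝ,
            ‖fderiv ℝ (fun z : ↥B → Fin D → ℝ => Real.exp (-(∑ a : Fin D, (z p a) ^ 2))) z‖ ≤ L ∧
            ‖iteratedFDeriv ℝ 2 (fun z : ↥B → Fin D → ℝ => Real.exp (-(∑ a : Fin D, (z p a) ^ 2))) z‖ ≤ L) ∧
        (ContDiff ℝ (⊤ : ℕ∞) (fun z : ↥B → Fin D → ℝ =>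
            Real.exp (-(∑ a : Fin D, (z p a) ^ 2)) * Real.exp (-(∑ a : Fin D, (z q a) ^ 2))) ∧
          ∀ z : ↥B → Fin D → ℝ,
            ‖fderiv ℝ (fun z : ↥B → Fin D → ℝ =>
                Real.exp (-(∑ a : Fin D, (z p a) ^ 2)) * Real.exp (-(∑ a : Fin D, (z q a) ^ 2))) z‖ ≤ L ∧
            ‖iteratedFDeriv ℝ 2 (fun z : ↥B → Fin D → ℝ =>
                Real.exp (-(∑ a : Fin D, (z p a) ^ 2)) * Real.exp (-(∑ a : Fin D, (z q a) ^ 2))) z‖ ≤ L))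
    (h₃ : ∀ (B : Finset (Literature.MathematicalPhysics.QuantumLattice.ZdPlaquette 4)) (D : ℕ) (p q : ↥B),
      (∫ z, Real.exp (-(∑ a : Fin D, (z p a) ^ 2)) * Real.exp (-(∑ a : Fin D, (z q a) ^ 2))
          ∂(Literature.MathematicalPhysics.QuantumFieldTheory.latticeMaxwellBlockLaw B D)) -
        (∫ z, Real.exp (-(∑ a : Fin D, (z p a) ^ 2))
          ∂(Literature.MathematicalPhysics.QuantumFieldTheory.latticeMaxwellBlockLaw B D)) *
        (∫ z, Real.exp (-(∑ a : Fin D, (z q a) ^ 2))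
          ∂(Literature.MathematicalPhysics.QuantumFieldTheory.latticeMaxwellBlockLaw B D)) =
      (2 : ℝ) ^ (-(D : ℝ)) *
        ((1 - (Literature.MathematicalPhysics.QuantumFieldTheory.curvatureTwoPoint (d := 4)
          (p : Literature.MathematicalPhysics.QuantumLattice.ZdPlaquette 4) q) ^ 2) ^ (-((D : ℝ) / 2)) - 1)) :
    Summit.QuantumFields.YangMills.Theses.SteinGapBootstrap.ProbeCovFromPairLawG := by
  sorry

end ProbeCovDirect

/-- **The crux `ProbeCovFromPairLawG` (stmt-QuantumFields-23640), by name, modulo the stubs of line `direct`.** -/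
theorem ProbeCovFromPairLawG_of : Summit.QuantumFields.YangMills.Theses.SteinGapBootstrap.ProbeCovFromPairLawG :=
  ProbeCovDirect.stub_assembly ProbeCovDirect.stub_axisProbe ProbeCovDirect.stub_gaussTest ProbeCovDirect.stub_gaussSide

/-- **The crux `UProbeCovFromPairLaw` (stmt-QuantumFields-23800, the alias), by name, modulo the same stubs.** -/
theorem UProbeCovFromPairLaw_of : Summit.QuantumFields.YangMills.Theses.SteinGapBootstrap.UProbeCovFromPairLaw :=
  ProbeCovFromPairLawG_of

end Summit.QuantumFields.YangMills.Theorems.SteinGapBootstrap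

end
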